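import Summits.AtomisticToContinuum.HydrodynamicLimit.Theorems.RelayRaceLocalityRestartPrincipleOfNoAnomalousDissipation
import Summits.AtomisticToContinuum.HydrodynamicLimit.Theorems.RelayRaceLocalityRestartPrincipleTightness
import HarnessLib

/-!
# Crux `RestartPrinciple` (stmt-AtomisticToContinuum-12503), line `isentropic-regibbsification` —
# the residue of the line as ONE unconditional equivalence

Lead c6. The line's skeleton (v8) has exactly one open stub, S4a `stub_noAnomalousDissipation` (the one-sided
speed-`N` "no anomalous dissipation" bound for the fresh LDA local Gibbs gas at a later time `t - s < τ₁(M)`),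
and `restartPrinciple_of_noAnomalousDissipation : S4a → RestartPrinciple` is landed (p120172). Lead c4's
reduction (R2, `renyiLocalEquilibriumLDA_of`, p117955) and lead c5's tightness
(`noAnomalousDissipation_of_renyiLocalEquilibrium`, p122144) say that S4a and the Rényi-`(1+γ)` short-time
local equilibrium of the LDA gas imply each other GIVEN the statics `stub_kineticEnergyExpMoment` (p117016),
`stub_staticFlatness` (p117520), `JaynesSqueeze.HardSphereLDA` (13459) and
`JaynesSqueeze.LocalGibbsConcentrationDilute` (13460). All four are CLOSED in the tree
(`hardSphereLDA_proof`, `localGibbsConcentrationDilute_proof`), so the equivalence is UNCONDITIONAL; this file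
records it as a single `Iff` (`noAnomalousDissipation_iff_renyiLocalEquilibrium`) so that the residue of the
line — and the statement a planner would promote to a crux-level item — can be cited by one name in either
currency. No definitions, no `sorry`.
-/

noncomputable section

open Literature.MathematicalPhysics.KineticTheory Literature.Analysis.FluidPDE
open Literature.Analysis.FunctionSpaces MeasureTheory Filter Set Topology
open Literature.Probability.Divergences InformationTheory
open scoped ENNReal

namespace Summit.AtomisticToContinuum.HydrodynamicLimit.Theorems.RestartPrinciple.IsentropicRegibbsification

/-- **The residue of line `isentropic-regibbsification` in two currencies.** The registered stub S4a
(`stub_noAnomalousDissipation`, left) — under the fresh LDA local Gibbs law at time `s`, the time-`t`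
log-likelihood pairing of the evolved configuration does not drop `δ` below its Euler value except with
probability `≤ C e^{-(N+1)/C}` — is EQUIVALENT to the Rényi-`(1+γ)` short-time local equilibrium of the LDA
gas (right): `∀ ε ∃ γ ∀ᶠ N, D_{1+γ}((Φ_{t-s})_# G_s ‖ G_t) ≤ ε (N+1)`. `→` is the reduction (R2) fed with the
closed statics; `←` is the Rényi change of measure against the static anchor.
[cite: Yau1991, §1; OllaVaradhanYau1993, §3; VanervenHarremoes2014, Def. 2] -/
theorem noAnomalousDissipation_iff_renyiLocalEquilibrium :
    (∃ η₀ : ℝ, 0 < η₀ ∧ ∃ σ₀ : ℝ, 0 < σ₀ ∧ ∀ σ : ℝ, 0 < σ → σ < σ₀ → ∀ M : ℝ, 0 < M →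
      ∃ τ₁ : ℝ, 0 < τ₁ ∧ ∀ (T : ℝ) (ρ θ : ℝ → T3 → ℝ) (u : ℝ → T3 → V3),
      IsHardSphereEulerSolution σ T ρ u θ → (∀ s' ∈ Set.Ico 0 T, ∫ x, ρ s' x = 1) →
      ∀ Φ : (N : ℕ) → HardSphereFlow (Torus.geometry (Fin 3)) (hsDiameter σ N) (N + 1),
      ∀ s ∈ Set.Ico 0 T, ∀ t ∈ Set.Ico s (min T (s + τ₁)),
      (∀ s' ∈ Set.Icc s t, ∀ x, ρ s' x * σ ^ 3 < η₀ ∧ ρ s' x ≤ M ∧ θ s' x ≤ M ∧ M⁻¹ ≤ θ s' x ∧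
      ‖u s' x‖ ≤ M ∧ ∀ i j k : Fin 3, |Torus.partialDeriv i (ρ s') x| ≤ M ∧
      ‖Torus.partialDeriv i (u s') x‖ ≤ M ∧ |Torus.partialDeriv i (θ s') x| ≤ M ∧
      |Torus.partialDeriv i (Torus.partialDeriv j (ρ s')) x| ≤ M ∧
      ‖Torus.partialDeriv i (Torus.partialDeriv j (u s')) x‖ ≤ M ∧
      |Torus.partialDeriv i (Torus.partialDeriv j (θ s')) x| ≤ M ∧
      |Torus.partialDeriv i (Torus.partialDeriv j (Torus.partialDeriv k (ρ s'))) x| ≤ M ∧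
      ‖Torus.partialDeriv i (Torus.partialDeriv j (Torus.partialDeriv k (u s'))) x‖ ≤ M ∧
      |Torus.partialDeriv i (Torus.partialDeriv j (Torus.partialDeriv k (θ s'))) x| ≤ M) →
      ∀ δ : ℝ, 0 < δ → ∃ C : ℝ, 0 < C ∧ ∀ N : ℕ,
      localGibbsLaw σ (fun x => ρ s x * Real.exp (hsExcessFreeEnergy (ρ s x * σ ^ 3) +
      ρ s x * σ ^ 3 * deriv hsExcessFreeEnergy (ρ s x * σ ^ 3))) (u s) (θ s) N (Φ N)
      {z | ((N : ℝ) + 1)⁻¹ * ∑ i, Real.log (localGibbsProfile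
      (fun x => ρ t x * Real.exp (hsExcessFreeEnergy (ρ t x * σ ^ 3) +
      ρ t x * σ ^ 3 * deriv hsExcessFreeEnergy (ρ t x * σ ^ 3))) (u t) (θ t)
      ((Φ N).flow (t - s) z i)) <
      (∫ x, ρ t x * (Real.log (ρ t x * Real.exp (hsExcessFreeEnergy (ρ t x * σ ^ 3) +
      ρ t x * σ ^ 3 * deriv hsExcessFreeEnergy (ρ t x * σ ^ 3))) -
      3 / 2 * Real.log (2 * Real.pi * θ t x) - 3 / 2)) - δ} ≤
      ENNReal.ofReal (C * Real.exp (-(C⁻¹ * (N + 1))))) ↔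
    (∃ η₀ : ℝ, 0 < η₀ ∧ ∃ σ₀ : ℝ, 0 < σ₀ ∧ ∀ σ : ℝ, 0 < σ → σ < σ₀ → ∀ M : ℝ, 0 < M →
      ∃ τ₁ : ℝ, 0 < τ₁ ∧ ∀ (T : ℝ) (ρ θ : ℝ → T3 → ℝ) (u : ℝ → T3 → V3),
      IsHardSphereEulerSolution σ T ρ u θ → (∀ s' ∈ Set.Ico 0 T, ∫ x, ρ s' x = 1) →
      ∀ Φ : (N : ℕ) → HardSphereFlow (Torus.geometry (Fin 3)) (hsDiameter σ N) (N + 1),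
      ∀ s ∈ Set.Ico 0 T, ∀ t ∈ Set.Ico s (min T (s + τ₁)),
      (∀ s' ∈ Set.Icc s t, ∀ x, ρ s' x * σ ^ 3 < η₀ ∧ ρ s' x ≤ M ∧ θ s' x ≤ M ∧ M⁻¹ ≤ θ s' x ∧
      ‖u s' x‖ ≤ M ∧ ∀ i j k : Fin 3, |Torus.partialDeriv i (ρ s') x| ≤ M ∧
      ‖Torus.partialDeriv i (u s') x‖ ≤ M ∧ |Torus.partialDeriv i (θ s') x| ≤ M ∧
      |Torus.partialDeriv i (Torus.partialDeriv j (ρ s')) x| ≤ M ∧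
      ‖Torus.partialDeriv i (Torus.partialDeriv j (u s')) x‖ ≤ M ∧
      |Torus.partialDeriv i (Torus.partialDeriv j (θ s')) x| ≤ M ∧
      |Torus.partialDeriv i (Torus.partialDeriv j (Torus.partialDeriv k (ρ s'))) x| ≤ M ∧
      ‖Torus.partialDeriv i (Torus.partialDeriv j (Torus.partialDeriv k (u s'))) x‖ ≤ M ∧
      |Torus.partialDeriv i (Torus.partialDeriv j (Torus.partialDeriv k (θ s'))) x| ≤ M) →
      ∀ ε : ℝ, 0 < ε → ∃ γ : ℝ, 0 < γ ∧ ∀ᶠ N : ℕ in atTop,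
      renyiDiv (1 + γ)
      ((Φ N).lawAt (localGibbsLaw σ (fun x => ρ s x * Real.exp (hsExcessFreeEnergy (ρ s x * σ ^ 3) +
      ρ s x * σ ^ 3 * deriv hsExcessFreeEnergy (ρ s x * σ ^ 3))) (u s) (θ s) N (Φ N)) (t - s))
      (localGibbsLaw σ (fun x => ρ t x * Real.exp (hsExcessFreeEnergy (ρ t x * σ ^ 3) +
      ρ t x * σ ^ 3 * deriv hsExcessFreeEnergy (ρ t x * σ ^ 3))) (u t) (θ t) N (Φ N)) ≤
      ENNReal.ofReal ε * ((N : ℝ≥0∞) + 1)) :=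
  ⟨fun h => renyiLocalEquilibriumLDA_of h stub_kineticEnergyExpMoment stub_staticFlatness
      hardSphereLDA_proof localGibbsConcentrationDilute_proof,
    noAnomalousDissipation_of_renyiLocalEquilibrium⟩

end Summit.AtomisticToContinuum.HydrodynamicLimit.Theorems.RestartPrinciple.IsentropicRegibbsification

end
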